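import Literature.AnabelianGeometry.EtaleTheta.XuuCocycleOfProp15
import HarnessLib

/-!
# [EtTh] Prop. 2.2 (ii) / Def. 2.7 in the §1 model: the choice `X̲̲` EXISTS from the named §1 facts

Mochizuki, *The étale theta function and its Frobenioid-theoretic manifestations*, Publ. RIMS **45**
(2009): Prop. 1.5 (ii), (iii) (PRIMS PDF p. 23), Def. 2.7 (p. 41: "`Π^tp_X̲/Π^tp_Ÿ ≅ (l·Z) × μ₂`", "it is a
tautology that, upon restriction to the covering `Ÿ̲̲ → Ÿ` …, the class `η̈^Θ` determines a class
`η̲̈^Θ ∈ H¹(Π^tp_Ÿ̲̲, l·Δ_Θ)`") [cite: MochizukiEtTh2009, Def 2.7 p.41].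

Cell abc-iut, layer L2, item N3 (seat abc-iut-L2-t7), row "x1 ⋈ §1 JUNCTION" (L2-lead 2026-08-26) —
capstone. PROOF-ONLY (0 definitions). `XuuCocycleOfClassLevel.lean` builds the choice `X̲̲` (seat
abc-iut-L2-t8's `DoubleUnderline`) from the §1 inputs and two class-level clauses; `XuuCocycleOfProp15.lean`
proves the `l·Z`-translate clause from `Prop15iii` + `Prop15ii` + `K = K̈` + `IsEtThOrigin`. HERE the sign
clause "every `ε ∈ Π^tp_Y` moves `η̈^Θ` by a class of square `1`" is derived as well (Prop. 1.5 (iii) at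
`a = 0`: `ε·x' = x'·log(u)`; the unit class is `ε`-fixed (Prop. 1.5 (ii), seat abc-iut-w5-d234's
invariance); `ε² ∈ Π^tp_Ÿ` acts innerly, so `log(u)² = 1`) — a private copy of the argument of seat
abc-iut-L2-t1's `Sec1DeckSign.exists_sq_eq_one_and_conj_eq` (the public theorem of record; its module's
build artefact is unavailable at the time of writing, hence the local helper), giving the capstone
**`nonempty_doubleUnderline_of_sectionOneFacts`**: the choice `X̲̲` of [EtTh] Def. 2.7 EXISTS in the §1 model
— all printed fields of `DoubleUnderline` proved — from EXACTLY `Compat` (a theorem), `Sec2Hyps` (`K = K̈`),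
the vacuity guard `IsEtThOrigin`, the named facts `Prop15iii`, `Prop15ii`, the cyclotome identification
`CyclotomeMod 1 l`, and `l` odd. No function-level input, no class-level binder, no new `Prop` fact.
Nothing of [EtTh] is asserted; typed ≠ endorsed; no side is taken on any disputed claim.
-/

noncomputable section

namespace Literature.AnabelianGeometry.EtaleTheta

open Literature.AnabelianGeometry.SemiGraphs
open scoped IsMulCommutative

namespace ThetaSetting

namespace EtaleThetaData

variable {p : ℕ} [Fact p.Prime] {D : ThetaSetting p} {E : D.EtaleThetaData}

/-- The sign clause `(P14ii-cl)` from Prop. 1.5 (iii) at `a = 0` and Prop. 1.5 (ii) (unit classes are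
`ε`-fixed), via the involution `ε² ∈ Π^tp_Ÿ` — a local copy of the argument of seat abc-iut-L2-t1's
`Sec1DeckSign.exists_sq_eq_one_and_conj_eq`, which is the theorem of record. [cite: MochizukiEtTh2009, Prop 1.5 (iii) p.23] -/
private theorem signClause_of_prop15 (hC : D.Compat) (hS : D.Sec2Hyps) (h15 : Prop15iii E hC)
    (h15ii : Prop15ii E.toKummerData hC) {ε : D.PiTemp} (hε : ε ∈ D.GtpY) :
    ∃ κ₁ : D.H1 D.GtpYdd, κ₁ ^ 2 = 1 ∧
      haveI := hC.GtpYdd_normal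
      ContH1.conj D.toTheta D.DeltaTheta ε E.etaDd = E.etaDd * κ₁ := by
  haveI := hC.GtpYdd_normal
  haveI := hC.GtpYddTheta_normal
  obtain ⟨x', ⟨hx', -, hΦ⟩, -⟩ := h15 E.etaDd E.etaDd_mem_thetaClasses
  obtain ⟨u, -, h⟩ := hΦ ε
  have ha : Multiplicative.toAdd (D.toZ ε) = 0 := by
    rw [show D.toZ ε = 1 from hε, toAdd_one]
  rw [ha] at h
  simp only [mul_zero, neg_zero, zpow_zero, mul_one] at h
  -- the unit class is `ε`-fixed; `ε² ∈ Π^tp_Ÿ` acts trivially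
  have hU : ContH1.conj (MonoidHom.id D.GtpTheta) D.DeltaTheta (D.toTheta ε)
      (E.kumYdd (E.toKddHat u)) = E.kumYdd (E.toKddHat u) :=
    conj_eq_self_of_mem_Fdd2_of_sec2Hyps hC hS (by rw [h15ii.Fdd2_eq]; exact ⟨_, rfl⟩) ε
  have hεε : ε * ε ∈ D.GtpYdd := by
    have h2 : (D.GtpYdd.subgroupOf D.GtpY).index = 2 := relIndex_GtpYdd_GtpY hS
    have := Subgroup.mul_self_mem_of_index_two h2 ⟨ε, hε⟩
    rw [Subgroup.mem_subgroupOf] at this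
    exact this
  have hfix : ContH1.conj (MonoidHom.id D.GtpTheta) D.DeltaTheta (D.toTheta (ε * ε)) x' = x' :=
    ContH1.conj_eq_self_of_mem _ (Subgroup.mem_map_of_mem D.toTheta hεε) x'
  rw [map_mul, ContH1.conj_mul_apply, h, map_mul, h, hU, mul_assoc] at hfix
  have hU2 : E.kumYdd (E.toKddHat u) ^ 2 = 1 := by
    rw [sq]
    exact mul_left_cancel (a := x') (by rw [mul_one]; exact hfix)
  refine ⟨D.inflTheta D.GtpYdd (E.kumYdd (E.toKddHat u)), by rw [← map_pow, hU2, map_one], ?_⟩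
  have e1 : ContH1.conj D.toTheta D.DeltaTheta ε (D.inflTheta D.GtpYdd x') =
      D.inflTheta D.GtpYdd (ContH1.conj (MonoidHom.id D.GtpTheta) D.DeltaTheta (D.toTheta ε) x') :=
    (ContH1.infl_conj (A := D.DeltaTheta) (ψ := D.toTheta) (hψ := D.continuous_toTheta)
      (H₀ := D.GtpYdd) (H' := D.GtpYdd.map D.toTheta) le_rfl ε x').symm
  rw [← hx', e1, h, map_mul]

/-- **The choice `X̲̲` exists in the §1 model — from the named §1 facts only.** Inputs BY NAME: `Compat`
(a theorem for every setting, `Sec1CompatHolds`), `K = K̈` (`Sec2Hyps`), the vacuity guard `IsEtThOrigin`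
(torsion-freeness of `Δ_Θ ≅ Ẑ(1)`), the named facts `Prop15iii` (normalisation of `η̈^Θ` over `Δ_Θ`; the
`μ₂`-generator; and — with `Prop15ii` — the `l·Z`-generator, `exists_translate_class_of_prop15`) and
`Prop15ii`, the cyclotome identification `CyclotomeMod 1 l` (`[Δ_Θ : l·Δ_Θ] = l`, `l·Δ_Θ` open), and `l`
odd. Output: seat abc-iut-L2-t8's `DoubleUnderline l` is inhabited, all its printed fields PROVED
(`doubleUnderlineOfInvariance`): Def. 2.7's "tautology" holds for the datum `η̈^Θ` itself.
[cite: MochizukiEtTh2009, Def 2.7 p.41] -/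
theorem nonempty_doubleUnderline_of_sectionOneFacts (hC : D.Compat) (hS : D.Sec2Hyps)
    (hO : D.IsEtThOrigin) (h15 : Prop15iii E hC) (h15ii : Prop15ii E.toKummerData hC) {l : ℕ+}
    (μ : D.CyclotomeMod 1 l) (hl : Odd (l : ℕ)) : Nonempty (E.DoubleUnderline l) :=
  nonempty_doubleUnderline_of_prop15_of_signClause hC hS hO h15 h15ii μ hl
    (fun _ hε => signClause_of_prop15 hC hS h15 h15ii hε)

/-- Equivalently: the cocycle input `XuuCocycleInput l` of `XuuCocycleOfCyclotome.lean` (seat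
abc-iut-L2-t7, gen 0) is inhabited under the same named §1 facts — the residual inputs "x1" (extension
of `η̈^Θ` modulo `l` to `Π^tp_X̲`) and "x2" (normalisation over `Δ_Θ`) of that construction are both
DISCHARGED. [cite: MochizukiEtTh2009, Def 2.7 p.41] -/
theorem nonempty_xuuCocycleInput_of_sectionOneFacts (hC : D.Compat) (hS : D.Sec2Hyps)
    (hO : D.IsEtThOrigin) (h15 : Prop15iii E hC) (h15ii : Prop15ii E.toKummerData hC) {l : ℕ+}
    (μ : D.CyclotomeMod 1 l) (hl : Odd (l : ℕ)) : Nonempty (E.XuuCocycleInput l) := by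
  haveI := hC.GtpYdd_normal
  obtain ⟨t, htZ, ht⟩ := exists_translate_class_of_prop15 hC hS hO h15 h15ii (l : ℕ)
  obtain ⟨t₁, ht₁, ht₁N⟩ := D.exists_mem_GtpY_not_mem_GtpYdd hS
  have h₁ : t₁ ∈ invModPowStabilizer E.etaDd (l : ℕ) :=
    mem_invModPowStabilizer_of_signClause (fun _ hε => signClause_of_prop15 hC hS h15 h15ii hε) hl ht₁
  exact nonempty_xuuCocycleInput_of_invariance hC hS h15 μ hl
    (invariant_modPow_of_generators hS E.etaDd (l : ℕ) hl.pos.ne' ht₁ ht₁N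
      ((mem_invModPowStabilizer_iff E.etaDd (l : ℕ) t₁).mp h₁) (mem_GtpXu_of_toZ_eq htZ)
      (toZDivL_eq_of_toZ_eq hl.pos.ne' htZ) ht)

end EtaleThetaData

end ThetaSetting

end Literature.AnabelianGeometry.EtaleTheta

end
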